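import Summits.NavierStokesRegularity.FluidComputer.GateBudgetSwingFloorCorotPrice
import Summits.NavierStokesRegularity.FluidComputer.GateBudgetDudCeiling
import HarnessLib

/-!
# GateBudget part 116 — the swing transfer from below, VIII: all clean runs re-counted (§307–§308)

Cell `pub-fluidc`, blueprint seat bp1 (gen 39, eleventh item); namespace
`Summit.NavierStokesRegularity.FluidComputer.GateBudget`, headline family
`RotorKnob.rotorCircuit K K¹⁰ ε ρ` (modes `0 = a` carrier, `1 = b` clock, `2 = c` trigger,
`3 = d` transfer, `4 = ã` output) from `delayInit`, trigger primitive `C` (`C' = c`), on the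
UNIT lattice `ε = K¹⁰ρ²`. Imports part 115 (`GateBudgetSwingFloorCorotPrice`: the headline
swing floor with the cross term; through it parts 100–114) and part 72 (`GateBudgetDudCeiling`:
the dud ceiling `N ≤ K⁹/7 + 1`; through it part 61 §190 `knob_pulse_exit`).
HONEST FRAMING: a low prior, high value-of-information experiment on Tao's machine paradigm;
NOT a claim that NS blows up. Nothing here is about the Navier–Stokes equations.

THE POINT (SPEC-INPUT-bp1 §CK(3)(c); the cross-term floor, third and last file). Part 113 §301
re-counted part 72 §219's dud ceiling `K⁹/7 + 1` with part 112's swing floor and got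
`ΘK⁹/(7·1.87) + 1` — but ONLY for runs whose transfer mode is small at every ignition,
`|d(rₙ)| ≤ 10⁻³`, because part 109's crude lock charges `|d(r)|` linearly (HONEST LIMIT (i) of
part 113). Part 115 §306 removed that charge: with the co-rotating lock `A = a² + d²`,
`φ₀ = arctan(d/a)` the band swing is `≥ (999/1000)/(θK⁹)·(1.937(a² - d²) - 0.027(a² + d²)
- 4.16W)` whenever `2d(r)² ≤ a(r)²`. (§307) Hence for EVERY normal-form ignition (`b(r) = θε`,
`5/4 ≤ θ ≤ 3/2`, `c(r) = ρ²/K⁹`) with small output pair `d(r)² + ã(r)² ≤ 1/50` — EXACTLY part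
72 §218's hypotheses, no condition on `d(r)` beyond the pair — the pulse of part 61 §190
(`r < T' ≤ r + 242/K⁹`, kept ring, `c > 0`, exit `b(T') = -θ'ε`, `θ' ≥ (31/32)θ`) carries part
100 §277's band and THE RUNG LEAKS AT LEAST `1.83/(θK⁹)`: on the energy sphere
`a² = 1 - (b² + c²) - (d² + ã²) ≥ 49/50 - 10⁻⁶ ≥ 2d²`, and `1.937(a² - d²) - 0.027(a² + d²)
= 1.91(1 - b² - c² - ã²) - 3.874d² ≥ 1.91 - 2·10⁻⁶ - 3.874/50`, `W ≤ 10⁻⁴`.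
(§308) THE DUD CEILING FOR ALL CLEAN RUNS: any run `r₀ < r₁ < …` of such ignitions
(pulse-separated, `θₙ ∈ [5/4, Θ]`, `5/4 ≤ Θ ≤ 3/2`) has `N ≤ ΘK⁹/(7·1.83) + 1` members —
`0.1171K⁹ + 1` at `Θ = 3/2`, `0.1132K⁹ + 1` at `Θ = 29/20` — under EXACTLY the hypotheses of
part 72 §219, which it therefore SUPERSEDES (`K⁹/7 + 1 = 0.1429K⁹ + 1`); part 113's
`0.1146K⁹ + 1` / `0.1108K⁹ + 1` remain marginally sharper on small-transfer runs. With part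
108's `0.0656K⁹` clean rungs certified from the other side, the clean dud horizon at `k = 1` lies
in `[0.0656K⁹, 0.1132K⁹ + 1]` for every clean run in the ladder's normal form, a factor `1.73`
(parts 98/72: `4.1`; 108/72: `2.16`; 108/113: `1.69` small-transfer only).

* §307 `knob_rung_leak_corot` (THE RUNG LEAK FOR ALL CLEAN IGNITIONS: `∃ T'`, `r < T'`,
  `T' - r ≤ 242/K⁹`, `ã(T') ≥ ã(r) + 1.83/(θK⁹)`); `knob_rung_leak_corot_after` (every
  `t ≥ r + 242/K⁹` inherits it).
* §308 `knob_dud_ceiling_corot` (THE DUD CEILING FOR ALL CLEAN RUNS: `N ≤ ΘK⁹/(7·1.83) + 1`).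

NUMBERS. `1.91 - 1.91·10⁻⁶ - 3.874/50 - 4.16·10⁻⁴ = 1.83210`, `× 0.999 = 1.83027 ≥ 1.83`;
`6L(T' - r) ≤ 6.6·242/2³² = 3.7·10⁻⁷ ≤ 10⁻⁴`; `243/K⁹ ≤ 243/2³⁶ ≤ θ/32`; `1/(7·1.83)
= 0.07806`: `Θ = 3/2 ↦ 0.1171`, `Θ = 29/20 ↦ 0.1132`, `Θ = 5/4 ↦ 0.0976`.
HONEST LIMITS. (i) `k = 1` (unit lattice) only — part 72 §219 holds on every lattice member and
is superseded only at `k = 1`; (ii) like §219 this bounds the NUMBER of clean small-pair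
ignitions, not the time to fire, and claims nothing about what the member does afterwards;
(iii) the constant `1.83` throws away `1.964d(r)²` and `1.91ã(r)²` — a run whose pair is
genuinely small leaks `≥ 1.90/(θK⁹)` per rung, not claimed here; (iv) the two-sided window is
quoted, not re-proved (part 108 is a separate file with the ladder's hypotheses); (v) nothing
about NS.
[cite: Tao2016AveragedNS, §5.5 Theorem 5.3, (5.5), (5.6), (b-eq), (c-eq), (d-eq), (ta-eq),
(energy-con)]
-/

noncomputable section

namespace Summit.NavierStokesRegularity.FluidComputer.GateBudget

open Real Set Filter Topology
open Literature.Analysis.FluidPDE.Tao2016AveragedNS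

variable {K M ε ρ : ℝ} {X : ℝ → Fin 5 → ℝ} {C : ℝ → ℝ}

/-! ## §307 The rung leak for all clean ignitions -/

/-- §307 THE RUNG LEAK FOR ALL CLEAN IGNITIONS (headline member from `delayInit` with a trigger
primitive `C`; `K ≥ 16`, `0 < ε`, `ε² ≤ 1/(6K²⁰)`, `0 < ρ`, UNIT LATTICE `ε = K¹⁰ρ²`; an
ignition `r ≥ 0` in normal form `b(r) = θε`, `5/4 ≤ θ ≤ 3/2`, `c(r) = ρ²/K⁹`, with small
output pair `d(r)² + ã(r)² ≤ 1/50` — EXACTLY part 72 §218's hypotheses on the unit lattice).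
Then the pulse of part 61 §190 (`r < T'`, `T' - r ≤ 242/K⁹`) ends with
`ã(T') ≥ ã(r) + 1.83/(θK⁹)` (part 72 §218: `+ 1/K⁹`; part 113 §300: `+ 1.87/(θK⁹)` if
`|d(r)| ≤ 10⁻³`): the exit `b(T') = -θ'ε`, `θ' ≥ θ - 243/K⁹ ≥ (31/32)θ` feeds part 100 §277,
whose band `[t₁, t₂] ⊆ (r, T']` part 115 §306 prices from below; `a(r)² ≥ 49/50 - 10⁻⁶ ≥ 2d(r)²`
by the energy sphere (`b(r)² + c(r)² ≤ 10⁻⁶`), `W ≤ 10⁻⁴`, and `ã` is monotone outside the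
band.
[derived: part 61 §190, part 100 §277, part 115 §306; RotorKnob (`traj_sum_sq_eq_one`,
`rotorCircuit_output_monotone`); Tao2016AveragedNS (5.6)] -/
theorem knob_rung_leak_corot
    (hX : ∀ t, HasDerivAt X (RotorKnob.rotorCircuit K (K ^ 10) ε ρ (X t)) t)
    (h0 : X 0 = delayInit) (hC : ∀ t, HasDerivAt C (X t 2) t) (hK : 16 ≤ K) (hε : 0 < ε)
    (hεK : ε ^ 2 ≤ 1 / (6 * K ^ 20)) (hρ : 0 < ρ) (hlat : ε = K ^ 10 * ρ ^ 2) {r θ : ℝ}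
    (hr : 0 ≤ r) (hθ1 : 5 / 4 ≤ θ) (hθ2 : θ ≤ 3 / 2) (hbr : X r 1 = θ * ε)
    (hcr : X r 2 = ρ ^ 2 / K ^ 9) (hPr : X r 3 ^ 2 + X r 4 ^ 2 ≤ 1 / 50) :
    ∃ T' : ℝ, r < T' ∧ T' - r ≤ 242 / K ^ 9 ∧ X r 4 + 183 / 100 / (θ * K ^ 9) ≤ X T' 4 := by
  have hK0 : (0 : ℝ) < K := by linarith
  have hK1 : (1 : ℝ) ≤ K := by linarith
  have hθ0 : (0 : ℝ) < θ := by linarith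
  have hK8 : (2 : ℝ) ^ 32 ≤ K ^ 8 := by
    calc (2 : ℝ) ^ 32 = 16 ^ 8 := by norm_num
      _ ≤ K ^ 8 := pow_le_pow_left₀ (by norm_num) hK 8
  have hK9 : (2 : ℝ) ^ 36 ≤ K ^ 9 := by
    calc (2 : ℝ) ^ 36 = 16 ^ 9 := by norm_num
      _ ≤ K ^ 9 := pow_le_pow_left₀ (by norm_num) hK 9
  have hK10 : (2 : ℝ) ^ 40 ≤ K ^ 10 := by
    calc (2 : ℝ) ^ 40 = 16 ^ 10 := by norm_num
      _ ≤ K ^ 10 := pow_le_pow_left₀ (by norm_num) hK 10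
  have hK9pos : (0 : ℝ) < K ^ 9 := by positivity
  have hK10pos : (0 : ℝ) < K ^ 10 := by positivity
  -- the unit lattice inside part 61's window
  have hKρ0 : 0 ≤ K ^ 10 * ρ ^ 2 := by positivity
  have hhi : K ^ 10 * ρ ^ 2 ≤ 2 * ε := by rw [hlat]; linarith only [hKρ0]
  have hρ2 : ρ ^ 2 = ε / K ^ 10 := by rw [eq_div_iff hK10pos.ne', hlat]; ring
  have hlo : 200 * ε / K ^ 20 ≤ ρ ^ 2 := by
    rw [hρ2, div_le_div_iff₀ (by positivity) hK10pos]
    have h20 : (200 : ℝ) * K ^ 10 ≤ K ^ 20 := by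
      rw [show K ^ 20 = K ^ 10 * K ^ 10 by ring]
      exact mul_le_mul_of_nonneg_right (le_trans (by norm_num) hK10) hK10pos.le
    calc 200 * ε * K ^ 10 = ε * (200 * K ^ 10) := by ring
      _ ≤ ε * K ^ 20 := mul_le_mul_of_nonneg_left h20 hε.le
  -- (1) the pulse (part 61 §190) and its exit below the band edge
  obtain ⟨T', θ', hrT, hτ, hpos, -, -, -, hbT, hθ'lo, -, hkept, -⟩ :=
    knob_pulse_exit hX h0 hK hε hρ hlo hhi hr hθ1 hθ2 hbr hcr
  have h243 : 243 / K ^ 9 ≤ 243 / 2 ^ 36 :=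
    div_le_div_of_nonneg_left (by norm_num) (by positivity) hK9
  have hbT' : X T' 1 ≤ -(31 / 32 * θ * ε) := by
    rw [hbT]
    have h : 31 / 32 * θ ≤ θ' := by linarith only [hθ'lo, h243, hθ1]
    nlinarith only [h, hε]
  -- (2) the band (part 100 §277)
  obtain ⟨t₁, t₂, hrt₁, ht₁₂, ht₂T, hb1, hb2, -, hband, -, hring, -, -, -, hdlo, hdhi⟩ :=
    pulse_swing_band hX h0 hC hK hε hρ hhi hrT.le hτ hθ1 hbr hcr hkept hpos hbT'
  -- (3) the entry data: `b(r)² + c(r)² ≤ 10⁻⁶`, `a(r)² ≥ 49/50 - 10⁻⁶` (part 72 §218 verbatim)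
  have hρε : ρ ^ 2 ≤ 2 * ε / K ^ 10 := by
    rw [le_div_iff₀ hK10pos]
    linarith only [hhi]
  have hc1 : ρ ^ 2 / K ^ 9 ≤ ε / 10 ^ 3 := by
    have e1 : ρ ^ 2 / K ^ 9 ≤ ρ ^ 2 := div_le_self (by positivity) (one_le_pow₀ hK1)
    have e3 : 2 * ε / K ^ 10 ≤ 2 * ε / 2 ^ 40 :=
      div_le_div_of_nonneg_left (by positivity) (by positivity) hK10
    have e4 : 2 * ε / 2 ^ 40 ≤ ε / 10 ^ 3 := by
      rw [div_le_div_iff₀ (by positivity) (by positivity)]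
      linarith only [hε]
    linarith only [e1, hρε, e3, e4]
  have hc2 : (ρ ^ 2 / K ^ 9) ^ 2 ≤ ε ^ 2 / 10 ^ 6 := by
    calc (ρ ^ 2 / K ^ 9) ^ 2 ≤ (ε / 10 ^ 3) ^ 2 := pow_le_pow_left₀ (by positivity) hc1 2
      _ = ε ^ 2 / 10 ^ 6 := by rw [div_pow]; norm_num
  have hbc : X r 1 ^ 2 + X r 2 ^ 2 ≤ 1 / 10 ^ 6 := by
    rw [hbr, hcr]
    have e1 : (θ * ε) ^ 2 ≤ (9 / 4) * ε ^ 2 := by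
      rw [mul_pow]
      exact mul_le_mul_of_nonneg_right (by nlinarith only [hθ1, hθ2]) (sq_nonneg ε)
    have hK20 : (2 : ℝ) ^ 80 ≤ K ^ 20 := by
      calc (2 : ℝ) ^ 80 = 16 ^ 20 := by norm_num
        _ ≤ K ^ 20 := pow_le_pow_left₀ (by norm_num) hK 20
    have e2 : ε ^ 2 ≤ 1 / (6 * 2 ^ 40) :=
      hεK.trans (div_le_div_of_nonneg_left (by norm_num) (by positivity)
        (by linarith only [hK20]))
    nlinarith only [e1, e2, hc2]
  have hA : 49 / 50 - 1 / 10 ^ 6 ≤ X r 0 ^ 2 := by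
    have hEq := RotorKnob.traj_sum_sq_eq_one hX h0 r
    linarith only [hEq, hbc, hPr]
  have ha : X r 0 ≠ 0 := by
    intro h
    rw [h] at hA
    norm_num at hA
  -- (4) the floor on the band (part 115 §306) and the monotone output outside it
  have had : 2 * X r 3 ^ 2 ≤ X r 0 ^ 2 := by linarith only [hA, hPr, sq_nonneg (X r 4)]
  have hfl := swing_headline_floor_corot hX h0 hC hK hε hlat hr hrt₁.le ht₁₂.le ht₂T hτ hθ1 ha
    had hcr hring hpos hb1 hb2 hband hdlo hdhi
  have hm1 : X r 4 ≤ X t₁ 4 := RotorKnob.rotorCircuit_output_monotone hK0.le hX hrt₁.le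
  have hm2 : X t₂ 4 ≤ X T' 4 := RotorKnob.rotorCircuit_output_monotone hK0.le hX ht₂T
  refine ⟨T', hrT, hτ, ?_⟩
  -- (5) the numerics: `W = 6L(T' - r) ≤ 10⁻⁴`, `1.91a² - 1.964d² ≥ 1.91 - 2·10⁻⁶ - 3.874/50`
  have hε1 : ε ≤ 4 / 5 := by
    have hb := (abs_le.1 (RotorKnob.traj_abs_le_one hX h0 r 1)).2
    rw [hbr] at hb
    nlinarith only [hb, hθ1, hε]
  have hρε' : ρ ^ 2 ≤ ε := by
    rw [hlat]; nlinarith only [one_le_pow₀ hK1 (n := 10), sq_nonneg ρ]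
  have hexp1 : exp (-K ^ 10) ≤ 1 := exp_le_one_iff.2 (by simp [pow_nonneg hK0.le])
  have heT : X T' 4 ≤ 1 := (abs_le.1 (RotorKnob.traj_abs_le_one hX h0 T' 4)).2
  have heT0 : 0 ≤ X T' 4 := RotorKnob.e_nonneg hX h0 hK0.le (hr.trans hrT.le)
  have hL : ε + ρ ^ 2 * exp (-K ^ 10) + K * X T' 4 ≤ 11 / 10 * K := by
    have h1 : ρ ^ 2 * exp (-K ^ 10) ≤ ρ ^ 2 := mul_le_of_le_one_right (sq_nonneg ρ) hexp1
    have h2 : K * X T' 4 ≤ K := mul_le_of_le_one_right hK0.le heT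
    linarith only [h1, h2, hε1, hρε', hK]
  have hL0 : 0 ≤ ε + ρ ^ 2 * exp (-K ^ 10) + K * X T' 4 := by positivity
  have hτ0 : 0 ≤ T' - r := by linarith only [hrT]
  have hKτ : K * (T' - r) ≤ 242 / 2 ^ 32 := by
    have h1 : K * (T' - r) * K ^ 8 ≤ 242 := by
      rw [show K * (T' - r) * K ^ 8 = (T' - r) * K ^ 9 by ring]
      exact (le_div_iff₀ hK9pos).1 hτ
    rw [le_div_iff₀ (by positivity)]
    exact (mul_le_mul_of_nonneg_left hK8 (by positivity)).trans h1
  have h6L : 6 * (ε + ρ ^ 2 * exp (-K ^ 10) + K * X T' 4) * (T' - r) ≤ 1 / 10 ^ 4 := by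
    calc 6 * (ε + ρ ^ 2 * exp (-K ^ 10) + K * X T' 4) * (T' - r)
        ≤ 6 * (11 / 10 * K) * (T' - r) :=
          mul_le_mul_of_nonneg_right (mul_le_mul_of_nonneg_left hL (by norm_num)) hτ0
      _ = 66 / 10 * (K * (T' - r)) := by ring
      _ ≤ 66 / 10 * (242 / 2 ^ 32) := mul_le_mul_of_nonneg_left hKτ (by norm_num)
      _ ≤ 1 / 10 ^ 4 := by norm_num
  have hEq := RotorKnob.traj_sum_sq_eq_one hX h0 r
  have key : 183 / 100 / (θ * K ^ 9)
      ≤ 999 / 1000 / (θ * K ^ 9) * (1937 / 1000 * (X r 0 ^ 2 - X r 3 ^ 2)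
          - 27 / 1000 * (X r 0 ^ 2 + X r 3 ^ 2)
          - 416 / 100 * (6 * (ε + ρ ^ 2 * exp (-K ^ 10) + K * X T' 4) * (T' - r))) := by
    rw [div_mul_eq_mul_div, mul_comm (999 / 1000 : ℝ), ← mul_div_assoc]
    refine div_le_div_of_nonneg_right ?_ (by positivity)
    linarith only [hEq, hbc, hPr, h6L, sq_nonneg (X r 4)]
  linarith only [hfl, key, hm1, hm2]

/-- §307 THE RUNG LEAK WITH THE CROSS-TERM FLOOR, after the pulse: in the setting of
`knob_rung_leak_corot`, `ã(t) ≥ ã(r) + 1.83/(θK⁹)` for every `t ≥ r + 242/K⁹` (the output is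
non-decreasing). [derived: this file §307; RotorKnob `rotorCircuit_output_monotone`] -/
theorem knob_rung_leak_corot_after
    (hX : ∀ t, HasDerivAt X (RotorKnob.rotorCircuit K (K ^ 10) ε ρ (X t)) t)
    (h0 : X 0 = delayInit) (hC : ∀ t, HasDerivAt C (X t 2) t) (hK : 16 ≤ K) (hε : 0 < ε)
    (hεK : ε ^ 2 ≤ 1 / (6 * K ^ 20)) (hρ : 0 < ρ) (hlat : ε = K ^ 10 * ρ ^ 2) {r θ : ℝ}
    (hr : 0 ≤ r) (hθ1 : 5 / 4 ≤ θ) (hθ2 : θ ≤ 3 / 2) (hbr : X r 1 = θ * ε)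
    (hcr : X r 2 = ρ ^ 2 / K ^ 9) (hPr : X r 3 ^ 2 + X r 4 ^ 2 ≤ 1 / 50) {t : ℝ}
    (ht : r + 242 / K ^ 9 ≤ t) : X r 4 + 183 / 100 / (θ * K ^ 9) ≤ X t 4 := by
  obtain ⟨T', -, hτ, hleak⟩ :=
    knob_rung_leak_corot hX h0 hC hK hε hεK hρ hlat hr hθ1 hθ2 hbr hcr hPr
  have hK0 : (0 : ℝ) ≤ K := by linarith
  have hmono := RotorKnob.rotorCircuit_output_monotone hK0 hX
    (show T' ≤ t by linarith only [hτ, ht])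
  exact hleak.trans hmono

/-! ## §308 The dud ceiling re-counted for all clean runs -/

/-- §308 THE DUD CEILING RE-COUNTED FOR ALL CLEAN RUNS (part 72 §219 with the cross-term floor;
part 113 §301 without its small-transfer hypothesis). Headline member from `delayInit` with a
trigger primitive `C`, `K ≥ 16`, `0 < ε`, `ε² ≤ 1/(6K²⁰)`, `0 < ρ`, UNIT LATTICE `ε = K¹⁰ρ²`.
Let `r₀, …, r_{N-1}` be ANY times with `r₀ ≥ 0` and `r_{n+1} ≥ r_n + 242/K⁹`, each a
normal-form ignition `b(r_n) = θ_nε`, `5/4 ≤ θ_n ≤ Θ` (`5/4 ≤ Θ ≤ 3/2`), `c(r_n) = ρ²/K⁹`, with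
small output pair `d(r_n)² + ã(r_n)² ≤ 1/50` — EXACTLY the hypotheses of part 72 §219. Then
`N ≤ ΘK⁹/(7·1.83) + 1` (`= 0.1171K⁹ + 1` at `Θ = 3/2`, `0.1132K⁹ + 1` at `Θ = 29/20`; part 72:
`K⁹/7 + 1 = 0.1429K⁹ + 1`; part 113: `ΘK⁹/(7·1.87) + 1` for `|d(r_n)| ≤ 10⁻³` only): by §307 the
output climbs `≥ 1.83/(ΘK⁹)` from each ignition to the next, starts `≥ 0` and is `≤ 1/7` at the
last one. This SUPERSEDES part 72 §219 outright.
[derived: this file §307; part 72 §219 (the count); Tao2016AveragedNS (5.6)] -/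
theorem knob_dud_ceiling_corot
    (hX : ∀ t, HasDerivAt X (RotorKnob.rotorCircuit K (K ^ 10) ε ρ (X t)) t)
    (h0 : X 0 = delayInit) (hC : ∀ t, HasDerivAt C (X t 2) t) (hK : 16 ≤ K) (hε : 0 < ε)
    (hεK : ε ^ 2 ≤ 1 / (6 * K ^ 20)) (hρ : 0 < ρ) (hlat : ε = K ^ 10 * ρ ^ 2) {Θ : ℝ}
    (hΘ1 : 5 / 4 ≤ Θ) (hΘ2 : Θ ≤ 3 / 2) {N : ℕ} {r θ : ℕ → ℝ} (hr0 : 0 ≤ r 0)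
    (hsep : ∀ n, n + 1 < N → r n + 242 / K ^ 9 ≤ r (n + 1))
    (hθ : ∀ n, n < N → 5 / 4 ≤ θ n ∧ θ n ≤ Θ) (hb : ∀ n, n < N → X (r n) 1 = θ n * ε)
    (hc : ∀ n, n < N → X (r n) 2 = ρ ^ 2 / K ^ 9)
    (hP : ∀ n, n < N → X (r n) 3 ^ 2 + X (r n) 4 ^ 2 ≤ 1 / 50) :
    (N : ℝ) ≤ Θ * K ^ 9 / (7 * (183 / 100)) + 1 := by
  have hK0 : (0 : ℝ) < K := by linarith
  have hK9 : (0 : ℝ) < K ^ 9 := by positivity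
  have hΘ0 : 0 < Θ := by linarith only [hΘ1]
  have hΘK : 0 < Θ * K ^ 9 := by positivity
  rcases Nat.eq_zero_or_pos N with hN | hN
  · rw [hN, Nat.cast_zero]
    positivity
  have claim : ∀ n, n < N → 0 ≤ r n ∧ X (r 0) 4 + n * (183 / 100) / (Θ * K ^ 9) ≤ X (r n) 4 := by
    intro n
    induction n with
    | zero =>
      intro _
      exact ⟨hr0, by rw [Nat.cast_zero, zero_mul, zero_div, add_zero]⟩
    | succ m ih =>
      intro hm
      have hm' : m < N := Nat.lt_of_succ_lt hm
      obtain ⟨hrm, hout⟩ := ih hm'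
      have hs := hsep m hm
      obtain ⟨hθlo, hθhi⟩ := hθ m hm'
      have hleak := knob_rung_leak_corot_after hX h0 hC hK hε hεK hρ hlat hrm hθlo
        (hθhi.trans hΘ2) (hb m hm') (hc m hm') (hP m hm') hs
      have hθ0 : 0 < θ m := by linarith only [hθlo]
      have hcmp : 183 / 100 / (Θ * K ^ 9) ≤ 183 / 100 / (θ m * K ^ 9) :=
        div_le_div_of_nonneg_left (by norm_num) (by positivity)
          (mul_le_mul_of_nonneg_right hθhi hK9.le)
      refine ⟨?_, ?_⟩
      · have : (0 : ℝ) ≤ 242 / K ^ 9 := by positivity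
        linarith only [hrm, hs, this]
      · rw [Nat.cast_succ, add_mul, one_mul, add_div]
        linarith only [hout, hleak, hcmp]
  have hlast : N - 1 < N := Nat.sub_lt hN Nat.one_pos
  obtain ⟨-, hout⟩ := claim (N - 1) hlast
  have he0 : 0 ≤ X (r 0) 4 := RotorKnob.e_nonneg hX h0 hK0.le hr0
  have heN : X (r (N - 1)) 4 ≤ 1 / 7 := by
    have h := hP (N - 1) hlast
    nlinarith only [h, sq_nonneg (X (r (N - 1)) 3), sq_nonneg (X (r (N - 1)) 4 - 1 / 7)]
  have hcast : ((N - 1 : ℕ) : ℝ) = N - 1 := by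
    rw [Nat.cast_sub hN, Nat.cast_one]
  rw [hcast] at hout
  have h1 : ((N : ℝ) - 1) * (183 / 100) / (Θ * K ^ 9) ≤ 1 / 7 := by
    linarith only [hout, he0, heN]
  rw [div_le_iff₀ hΘK] at h1
  rw [div_add_one (by norm_num : (7 * (183 / 100) : ℝ) ≠ 0), le_div_iff₀ (by norm_num)]
  linarith only [h1]

end Summit.NavierStokesRegularity.FluidComputer.GateBudget
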